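import Mathlib
import HarnessLib
import Summits.HubbardSuperconductivity.HubbardSuperconductivity.Theorems.KLProgrammeKLRegimeEnginePairLadderDuhamel

/-!
# Route `KLProgramme` — crux K3, ENGINE child gen 5 (stmt-HubbardSuperconductivity-19918 `KLRegimeEngineV14`), stub `stub_engine_step_values`,
# conjunct (E2-v9) at `1 ≤ n`: the Wick pair-ladder step from the within-slice flow, LOCALISED to the momentum carrier — `kltc_wickStep_of_flow`

Cell gate-hubbard-kl, seat hubbard-kl-k3c1-p1 (g5), technique «composed-map remainder propagation».  Assembly of the continuous (E2) organisation's
bridge (HOME/hubbard-kl-k3c1-p1/E2-CONTINUOUS-ROUTE.md, evidence #24 on 19918) into the INPUT FORMAT of the tower composition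
(`kltc_tower_compose_fwd`, p496062): the flow `Γ̇ = −Γ·diag ḃ·Γ + X` lives on the product carrier `S × F` (momentum × Matsubara index; the Wick
pair vertex at general pair frequencies), the tower on `S` (values at the reference frequency).  `kltc_riccati_duhamel_weighted` (p500198) gives
`Γ(1) ≈ F_{b(1)−b(0)}(Γ(0))` on `S × F` with error `FT_ρ(∫|X|)`; `klell_localised_ladder_rightInverse` (p466393) localises the resummation of the rung
`K = Γ(0)` to the resummation of a frequency-blind base array `C` on `S` with the AGGREGATED weights `w_s = Σ_ν (b(1) − b(0))(s,ν)`, at the price of the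
weighted four-term expression in `K − C^ext`.  Result **`kltc_wickStep_of_flow`**: `∃ N` two-sided inverse of `1 + diag w·C` on `S` with
`‖Γ(1)(x,y) − (C·N)(x.1,y.1)‖ ≤ FT_ρ(∫|X|)(x,y) + [‖K − C^ext‖ four-term at (x,y)]` for all `x, y : S × F` — read at the external pair indices this is the
(W-a) relation `Y ≈ C·N` of the tower with an entrywise majorant of the (E2-v9) shape.  Exact algebra + the landed analysis; nothing about the model
is asserted.  0 kit.
-/

noncomputable section

namespace Summit.HubbardSuperconductivity.HubbardSuperconductivity.Theorems.KLRegimeSplit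

set_option linter.dupNamespace false -- summit = problem name (single-conjunct summit), D-0017

open Finset Matrix Set Literature.MathematicalPhysics.QuantumLattice Literature.Probability.LatticeModels
open Summit.HubbardSuperconductivity.HubbardSuperconductivity.Theorems.KLProgrammeCooperResummation

section Generic

variable {S F : Type*} [Fintype S] [DecidableEq S] [Nonempty S] [Fintype F] [DecidableEq F] [Nonempty F]

/-- **The Wick pair-ladder step from the within-slice flow, localised.**  Flow data on `S × F` as in `kltc_riccati_duhamel_weighted`
(`Γ, Γ̇, X`, rungs `b, ḃ`, a priori `|Γ(t)| ≤ m`, rate `β`, tail profile `ρ`, `(3/2)m·Σρ ≤ 1/3`), a frequency-blind base array `C` on `S` with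
`|C| ≤ m₀` and `m₀·Σρ ≤ 1/3`.  THEN, with `z′ := b(1) − b(0)` and the aggregated weights `w_s = Σ_ν z′(s,ν)`: `∃ N` two-sided inverse of
`1 + diag w·C` with `|C·N| ≤ (3/2)m₀` and, for all `x y : S × F`,
`‖Γ(1)(x,y) − (C·N)(x.1,y.1)‖ ≤ [I(x,y) + (3/2)(3/2 m)Σ_c I(x,c)ρ_c + (3/2)mΣ_a ρ_a I(a,y) + (9/4)m(3/2 m)ΣΣ ρ I ρ]
 + [‖K(x,y) − C(x.1,y.1)‖ + (3/2)m₀Σ_c‖K(x,c) − C(x.1,c.1)‖‖z′_c‖ + (3/2)mΣ_a‖z′_a‖‖K(a,y) − C(a.1,y.1)‖ + (9/4)m m₀ΣΣ‖z′‖‖K − C^ext‖‖z′‖]`,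
`I = ∫₀¹|X|`, `K = Γ(0)`. -/
theorem kltc_wickStep_of_flow (C : Matrix S S ℂ) (Γ Γ' X : ℝ → Matrix (S × F) (S × F) ℂ) (b b' : ℝ → S × F → ℂ) (ρ : S × F → ℝ)
    {m m₀ β : ℝ} (hm : 0 ≤ m) (hm₀ : 0 ≤ m₀) (hC : ∀ s t, ‖C s t‖ ≤ m₀)
    (hΓ : ∀ t ∈ Icc (0 : ℝ) 1, ∀ x y, HasDerivAt (fun s => Γ s x y) (Γ' t x y) t)
    (hb : ∀ t ∈ Icc (0 : ℝ) 1, ∀ a, HasDerivAt (fun s => b s a) (b' t a) t)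
    (hΓ'c : ∀ x y, ContinuousOn (fun t => Γ' t x y) (Icc 0 1)) (hb'c : ∀ a, ContinuousOn (fun t => b' t a) (Icc 0 1))
    (hX : ∀ t ∈ Icc (0 : ℝ) 1, X t = Γ' t + Γ t * diagonal (b' t) * Γ t)
    (hΓm : ∀ t ∈ Icc (0 : ℝ) 1, ∀ x y, ‖Γ t x y‖ ≤ m) (hβ : ∀ t ∈ Icc (0 : ℝ) 1, ∑ a, ‖b' t a‖ ≤ β)
    (hρ : ∀ t ∈ Icc (0 : ℝ) 1, ∀ a, ‖b 1 a - b t a‖ ≤ ρ a) (hsm : 3 / 2 * m * ∑ a, ρ a ≤ 1 / 3) (hsm₀ : m₀ * ∑ a, ρ a ≤ 1 / 3) :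
    ∃ N : Matrix S S ℂ, (1 + diagonal (fun s => ∑ c : F, (b 1 - b 0) (s, c)) * C) * N = 1 ∧
      N * (1 + diagonal (fun s => ∑ c : F, (b 1 - b 0) (s, c)) * C) = 1 ∧ (∀ s t, ‖(C * N) s t‖ ≤ 3 / 2 * m₀) ∧
      ∀ x y : S × F, ‖Γ 1 x y - (C * N) x.1 y.1‖ ≤
        ((∫ t in (0 : ℝ)..1, ‖X t x y‖) + 3 / 2 * (3 / 2 * m) * ∑ c, (∫ t in (0 : ℝ)..1, ‖X t x c‖) * ρ c +
          3 / 2 * m * ∑ a, ρ a * (∫ t in (0 : ℝ)..1, ‖X t a y‖) +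
            9 / 4 * m * (3 / 2 * m) * ∑ a, ∑ c, ρ a * (∫ t in (0 : ℝ)..1, ‖X t a c‖) * ρ c) +
        (‖Γ 0 x y - C x.1 y.1‖ + 3 / 2 * m₀ * ∑ c, ‖Γ 0 x c - C x.1 c.1‖ * ‖(b 1 - b 0) c‖ +
          3 / 2 * m * ∑ a, ‖(b 1 - b 0) a‖ * ‖Γ 0 a y - C a.1 y.1‖ +
            9 / 4 * m * m₀ * ∑ a, ∑ c, ‖(b 1 - b 0) a‖ * ‖Γ 0 a c - C a.1 c.1‖ * ‖(b 1 - b 0) c‖) := by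
  have h01 : (0 : ℝ) ∈ Icc (0 : ℝ) 1 := ⟨le_rfl, zero_le_one⟩
  -- the Duhamel comparison on the product carrier
  obtain ⟨ND, hND1, -, hDuh⟩ := kltc_riccati_duhamel_weighted Γ Γ' X b b' ρ hm hΓ hb hΓ'c hb'c hX hΓm hβ hρ hsm
  -- masses of the step weight
  set z' : S × F → ℂ := b 1 - b 0 with hz'_def
  have hz'ρ : ∀ a, ‖z' a‖ ≤ ρ a := fun a => by rw [hz'_def, Pi.sub_apply]; exact hρ 0 h01 a
  have hZ_le : ∑ a, ‖z' a‖ ≤ ∑ a, ρ a := sum_le_sum fun a _ => hz'ρ a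
  have hZ0 : 0 ≤ ∑ a, ρ a := (sum_nonneg fun a _ => norm_nonneg _).trans hZ_le
  have hzK : m * ∑ a, ‖z' a‖ ≤ 1 / 3 :=
    ((mul_le_mul_of_nonneg_left hZ_le hm).trans (mul_le_mul_of_nonneg_right (by linarith : m ≤ 3 / 2 * m) hZ0)).trans hsm
  have hzC : m₀ * ∑ a, ‖z' a‖ ≤ 1 / 3 := (mul_le_mul_of_nonneg_left hZ_le hm₀).trans hsm₀
  -- the Duhamel resummation is the ladder sum of the rung `K = Γ 0`
  have hTK := (klcrs_single_slice_ladder_hasSum z' hm (Γ 0) (hΓm 0 h01) hzK ND hND1).2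
  -- localisation to the momentum carrier
  obtain ⟨N, hN1, hN2, hCN, -, hloc⟩ := klell_localised_ladder_rightInverse C (Γ 0) z' hm₀ hm hC (hΓm 0 h01) hzC hzK (Γ 0 * ND) hTK
  refine ⟨N, hN1, hN2, hCN, fun x y => ?_⟩
  have hsplit : Γ 1 x y - (C * N) x.1 y.1 = (Γ 1 x y - (Γ 0 * ND) x y) + ((Γ 0 * ND) x y - (C * N) x.1 y.1) := by ring
  rw [hsplit]
  exact (norm_add_le _ _).trans (add_le_add (hDuh x y) (hloc x y))

/-! ## §2 (append) The plain increment of the flow — the (E2″)/(E2′) value increments need no resummation -/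

omit [Nonempty S] [Nonempty F] in
/-- **Increment of the within-slice flow.**  Under the hypotheses of `kltc_riccati_duhamel_weighted` (only the derivative/continuity data, the
flow equation and the a priori bound are used): `‖Γ(1)(x,y) − Γ(0)(x,y)‖ ≤ ∫₀¹‖X(t)(x,y)‖dt + m²·∫₀¹ Σ_c‖ḃ(t)_c‖dt` — the pp part is the
rung-rate mass times `m²` (ppGain-shaped in the pair class through that mass), the rest is the source. -/
theorem kltc_increment_of_flow (Γ Γ' X : ℝ → Matrix (S × F) (S × F) ℂ) (b' : ℝ → S × F → ℂ) {m : ℝ} (hm : 0 ≤ m)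
    (hΓ : ∀ t ∈ Icc (0 : ℝ) 1, ∀ x y, HasDerivAt (fun s => Γ s x y) (Γ' t x y) t)
    (hΓ'c : ∀ x y, ContinuousOn (fun t => Γ' t x y) (Icc 0 1)) (hb'c : ∀ a, ContinuousOn (fun t => b' t a) (Icc 0 1))
    (hX : ∀ t ∈ Icc (0 : ℝ) 1, X t = Γ' t + Γ t * diagonal (b' t) * Γ t)
    (hΓm : ∀ t ∈ Icc (0 : ℝ) 1, ∀ x y, ‖Γ t x y‖ ≤ m) (x y : S × F) :
    ‖Γ 1 x y - Γ 0 x y‖ ≤ (∫ t in (0 : ℝ)..1, ‖X t x y‖) + m ^ 2 * ∫ t in (0 : ℝ)..1, ∑ c, ‖b' t c‖ := by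
  have hsub : uIcc (0 : ℝ) 1 ⊆ Icc (0 : ℝ) 1 := by rw [Set.uIcc_of_le zero_le_one]
  have hΓc : ∀ x y, ContinuousOn (fun t => Γ t x y) (Icc 0 1) := fun x y t ht => (hΓ t ht x y).continuousAt.continuousWithinAt
  have hGd : ContinuousOn (fun t => (Γ t * diagonal (b' t) * Γ t) x y) (Icc 0 1) := by
    have h : ∀ t, (Γ t * diagonal (b' t) * Γ t) x y = ∑ a, Γ t x a * b' t a * Γ t a y := fun t => klli_mul_diag_mul_apply _ _ _ _ _
    simp_rw [h]
    exact continuousOn_finsetSum _ fun a _ => ((hΓc x a).mul (hb'c a)).mul (hΓc a y)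
  have hXc : ContinuousOn (fun t => X t x y) (Icc 0 1) := by
    have h : ∀ t ∈ Icc (0 : ℝ) 1, X t x y = Γ' t x y + (Γ t * diagonal (b' t) * Γ t) x y := fun t ht => by
      rw [hX t ht, Matrix.add_apply]
    exact ((hΓ'c x y).add hGd).congr h
  have hBc : ContinuousOn (fun t => ∑ c, ‖b' t c‖) (Icc 0 1) := continuousOn_finsetSum _ fun c _ => (hb'c c).norm
  have hXint : IntervalIntegrable (fun t => X t x y) MeasureTheory.volume 0 1 := (hXc.mono hsub).intervalIntegrable
  have hGint : IntervalIntegrable (fun t => (Γ t * diagonal (b' t) * Γ t) x y) MeasureTheory.volume 0 1 := (hGd.mono hsub).intervalIntegrable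
  have hBint : IntervalIntegrable (fun t => ∑ c, ‖b' t c‖) MeasureTheory.volume 0 1 := (hBc.mono hsub).intervalIntegrable
  -- FTC
  have hFTC : (∫ t in (0 : ℝ)..1, Γ' t x y) = Γ 1 x y - Γ 0 x y :=
    intervalIntegral.integral_eq_sub_of_hasDerivAt (fun t ht => hΓ t (hsub ht) x y) ((hΓ'c x y).mono hsub).intervalIntegrable
  have hid : Γ 1 x y - Γ 0 x y = ∫ t in (0 : ℝ)..1, (X t x y - (Γ t * diagonal (b' t) * Γ t) x y) := by
    rw [← hFTC]
    refine intervalIntegral.integral_congr fun t ht => ?_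
    have hXt := congrArg (fun M : Matrix (S × F) (S × F) ℂ => M x y) (hX t (hsub ht))
    simp only [Matrix.add_apply] at hXt
    rw [hXt]; ring
  rw [hid]
  have hg : IntervalIntegrable (fun t => ‖X t x y‖ + m ^ 2 * ∑ c, ‖b' t c‖) MeasureTheory.volume 0 1 :=
    hXint.norm.add (hBint.const_mul _)
  refine (intervalIntegral.norm_integral_le_of_norm_le zero_le_one ?_ hg).trans (le_of_eq ?_)
  · refine Filter.Eventually.of_forall fun t ht => ?_
    have ht' : t ∈ Icc (0 : ℝ) 1 := ⟨ht.1.le, ht.2⟩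
    have hG : ‖(Γ t * diagonal (b' t) * Γ t) x y‖ ≤ m ^ 2 * ∑ c, ‖b' t c‖ := by
      refine (klell_norm_mul_diag_mul_apply_le (Γ t) (Γ t) (b' t) x y).trans ?_
      rw [mul_sum]
      exact sum_le_sum fun c _ => by
        calc ‖Γ t x c‖ * ‖b' t c‖ * ‖Γ t c y‖ ≤ m * ‖b' t c‖ * m :=
              mul_le_mul (mul_le_mul_of_nonneg_right (hΓm t ht' x c) (norm_nonneg _)) (hΓm t ht' c y) (norm_nonneg _)
                (mul_nonneg hm (norm_nonneg _))
          _ = m ^ 2 * ‖b' t c‖ := by ring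
    calc ‖X t x y - (Γ t * diagonal (b' t) * Γ t) x y‖ ≤ ‖X t x y‖ + ‖(Γ t * diagonal (b' t) * Γ t) x y‖ := norm_sub_le _ _
      _ ≤ ‖X t x y‖ + m ^ 2 * ∑ c, ‖b' t c‖ := by linarith
  · rw [intervalIntegral.integral_add hXint.norm (hBint.const_mul _), intervalIntegral.integral_const_mul]

end Generic

end Summit.HubbardSuperconductivity.HubbardSuperconductivity.Theorems.KLRegimeSplit

end
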